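import Summits.ABC.IUTFork.Cor312SoundInput
import Summits.ABC.IUTFork.Cor312ColumnTransport
import Summits.ABC.IUTFork.Cor312QTwist
import HarnessLib

/-!
# [IUTchIII] Cor. 3.12 — the gap statement of record is orbit-canonical (GapA under the C-twists)

Record-only file (D-0012) of the abc-iut cell (D-0067 Cor. 3.12 strategy TEAM C «étale-picture /
multiradiality», seat abc-iut-c312-13, row C-8 of `HOME/plan/C312-TEAMS.md`); TAKES NO SIDE. A1's
`Cor312SoundInput.lean` types **GapA** = `SoundAtInput` ([IUTchIII] proof of Cor. 3.12, Step (xi-f),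
kurims `paper:url-4b091feeb646` p. 184 l. 19–24) — the isolated non-following inference of record
(GAP-LEDGER row G-c312-9-1). This file ADVERSARY-PROOFS that row against "the isolated statement depends
on unforced choices": `SoundAtInput` is INVARIANT under every re-choice the frozen types leave open —
§2 the Θ-side Kummer re-choice (`twistGlue`, row C-1; the (Ind1)(Ind2) re-choice of p. 173 l. 49 –
p. 174 l. 3): `twistGlue_soundAtInput_iff`, NO volume hypothesis (input-parameterized orbit absorption);
§3 the column (`recolumn`, row C-3; Steps (viii)–(ix), p. 180 l. 1–42): `recolumn_soundAtInput_iff`,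
and under the typed Thm. 3.11 (i) étale-symmetry (`Situation.MultiradialCompat`, a HYPOTHESIS) GapA is
column-independent (`exists_recolumn_soundAtInput_of_multiradialCompat`); §4 the q-side re-choice
(`qTwistGlue`, row C-7; Step (x) p. 181 l. 2–5): invariant modulo generator volume invariance AND
per-object admissibility of the q-glue (`hadm`, EXPLICIT — the frozen `Setting` constrains only the
q-pilot's image, `qRegion_mem`); §5 composition. CONSEQUENCE: GapA does not depend on the Kummer
representative within its (Ind1)(Ind2) orbit on either glue, nor on the vertical line carrying the
comparison. §1 is the `possibleImagesAt` orbit algebra (row C-1 with the input free). Deliberately NOT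
here: any claim that `SoundAtInput` holds or fails for an instantiated setting (Team R's contact file);
any derivation of the set-level (xi-f) inclusion from these invariances — there is none
(`ForkInd1Passive.setLevel_forces_active`, c312-4 `mainGoal_is_the_extra_input`). Nothing here asserts
Cor. 3.12. [claim: Mochizuki2012, status: disputed] for the quoted clauses; proofs are [folklore].
-/

noncomputable section

namespace Summit.ABC

namespace IUTFork

namespace Cor312Vol

open Thm311 Cor312 Literature.IUT.LogThetaLattice

variable {T : ThetaIndex} {S : Situation T} (P : Cor312.Setting S)

/-! ## 1. Orbit algebra at an arbitrary input (the `possibleImagesAt` mirrors of row C-1) -/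

/-- `Setting.image_mem_possibleImages` with the input free. [folklore] -/
theorem image_mem_possibleImagesAt {j : T.Label} {vQ : T.VQ} {Φ : S.L.PacketAut}
    (hΦ : Φ ∈ Setting.indGroup S) (o : P.Ob P.sig.Clgp) {U : Set (S.L.Packet j vQ)}
    (hU : U ∈ possibleImagesAt P o j vQ) : Φ j vQ '' U ∈ possibleImagesAt P o j vQ := by
  obtain ⟨Ψ, hΨ, rfl⟩ := hU
  refine ⟨Φ * Ψ, (Setting.indGroup S).mul_mem hΦ hΨ, ?_⟩
  rw [Setting.coe_mul_apply, Set.image_comp]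

/-- `Setting.image_possibleImages_eq` with the input free. [folklore] -/
theorem image_possibleImagesAt_eq {j : T.Label} {vQ : T.VQ} {Φ : S.L.PacketAut}
    (hΦ : Φ ∈ Setting.indGroup S) (o : P.Ob P.sig.Clgp) :
    (Set.image ⇑(Φ j vQ)) '' possibleImagesAt P o j vQ = possibleImagesAt P o j vQ := by
  refine Set.Subset.antisymm ?_ ?_
  · rintro _ ⟨U, hU, rfl⟩
    exact image_mem_possibleImagesAt P hΦ o hU
  · intro U hU
    refine ⟨Φ⁻¹ j vQ '' U, image_mem_possibleImagesAt P ((Setting.indGroup S).inv_mem hΦ) o hU, ?_⟩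
    rw [Setting.coe_inv_apply, Set.image_image]
    simp only [LinearEquiv.apply_symm_apply, Set.image_id']

/-- `Setting.image_sUnion_possibleImages` with the input free. [folklore] -/
theorem image_sUnion_possibleImagesAt {j : T.Label} {vQ : T.VQ} {Φ : S.L.PacketAut}
    (hΦ : Φ ∈ Setting.indGroup S) (o : P.Ob P.sig.Clgp) :
    Φ j vQ '' ⋃₀ possibleImagesAt P o j vQ = ⋃₀ possibleImagesAt P o j vQ := by
  conv_rhs => rw [← image_possibleImagesAt_eq P hΦ o (j := j) (vQ := vQ)]
  rw [Set.sUnion_image, Set.image_sUnion, Set.sUnion_image]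

/-- `Setting.symm_image_sUnion_possibleImages` with the input free. [folklore] -/
theorem symm_image_sUnion_possibleImagesAt {j : T.Label} {vQ : T.VQ} {Φ : S.L.PacketAut}
    (hΦ : Φ ∈ Setting.indGroup S) (o : P.Ob P.sig.Clgp) :
    ⇑(Φ j vQ).symm '' ⋃₀ possibleImagesAt P o j vQ = ⋃₀ possibleImagesAt P o j vQ := by
  conv_lhs => rw [← image_sUnion_possibleImagesAt P hΦ o (j := j) (vQ := vQ)]
  rw [Setting.image_symm_image]

/-! ## 2. The Θ-side Kummer re-choice: GapA is invariant with no hypothesis (row C-1 at every input) -/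

section ThetaTwist
variable (Φ₀ : S.L.PacketAut)

/-- The twisted Θ-glue at an arbitrary input is the `Φ₀`-translate (definitional). [folklore] -/
theorem twistGlue_thetaRegionOfAt (m : ℤ) (o : P.Ob P.sig.Clgp) (j : T.Label) (vQ : T.VQ) :
    (P.twistGlue Φ₀).thetaRegionOf m o j vQ = Φ₀ j vQ '' P.thetaRegionOf m o j vQ := rfl

/-- The twisted (Ind3)-enlarged image of an arbitrary input is the `Φ₀`-translate. [folklore] -/
theorem twistGlue_thetaRegion3At (o : P.Ob P.sig.Clgp) (j : T.Label) (vQ : T.VQ) :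
    thetaRegion3At (P.twistGlue Φ₀) o j vQ = Φ₀ j vQ '' thetaRegion3At P o j vQ := by
  unfold thetaRegion3At
  simp only [twistGlue_thetaRegionOfAt, Set.image_iUnion]

/-- **Orbit absorption at every input**: same possible images of EVERY object (row C-1's
`twistGlue_possibleImages`, input free). [folklore] -/
theorem twistGlue_possibleImagesAt (hΦ₀ : Φ₀ ∈ Setting.indGroup S) (o : P.Ob P.sig.Clgp)
    (j : T.Label) (vQ : T.VQ) :
    possibleImagesAt (P.twistGlue Φ₀) o j vQ = possibleImagesAt P o j vQ := by
  unfold possibleImagesAt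
  ext U
  simp only [Set.mem_setOf_eq, twistGlue_thetaRegion3At]
  constructor
  · rintro ⟨Φ, hΦ, rfl⟩
    refine ⟨Φ * Φ₀, (Setting.indGroup S).mul_mem hΦ hΦ₀, ?_⟩
    rw [Setting.coe_mul_apply, Set.image_comp]
  · rintro ⟨Φ, hΦ, rfl⟩
    refine ⟨Φ * Φ₀⁻¹, (Setting.indGroup S).mul_mem hΦ ((Setting.indGroup S).inv_mem hΦ₀), ?_⟩
    rw [Setting.coe_mul_apply, Set.image_comp, Setting.coe_inv_apply, Setting.image_symm_image]

/-- The packet hull of an arbitrary input is twist-invariant. [folklore] -/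
theorem twistGlue_thetaHullAt (hΦ₀ : Φ₀ ∈ Setting.indGroup S) (o : P.Ob P.sig.Clgp)
    (j : T.Label) (vQ : T.VQ) :
    thetaHullAt (P.twistGlue Φ₀) o j vQ = thetaHullAt P o j vQ := by
  have hfr : (P.twistGlue Φ₀).frame j vQ = P.frame j vQ := rfl
  unfold thetaHullAt
  rw [twistGlue_possibleImagesAt P Φ₀ hΦ₀ o j vQ, hfr]

/-- Hull-definedness of an arbitrary input is twist-invariant. [folklore] -/
theorem twistGlue_hullDefinedAt_iff (hΦ₀ : Φ₀ ∈ Setting.indGroup S) (o : P.Ob P.sig.Clgp)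
    (j : T.Label) (vQ : T.VQ) :
    HullDefinedAt (P.twistGlue Φ₀) o j vQ ↔ HullDefinedAt P o j vQ := by
  have hfr : (P.twistGlue Φ₀).frame j vQ = P.frame j vQ := rfl
  unfold HullDefinedAt
  rw [twistGlue_possibleImagesAt P Φ₀ hΦ₀ o j vQ, hfr]

/-- The local hull volume of an arbitrary input is twist-invariant. [folklore] -/
theorem twistGlue_thetaLocalAt (hΦ₀ : Φ₀ ∈ Setting.indGroup S) (o : P.Ob P.sig.Clgp)
    (j : T.Label) (vQ : T.VQ) :
    thetaLocalAt (P.twistGlue Φ₀) o j vQ = thetaLocalAt P o j vQ := by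
  have hd := twistGlue_hullDefinedAt_iff P Φ₀ hΦ₀ o j vQ
  have hh := twistGlue_thetaHullAt P Φ₀ hΦ₀ o j vQ
  have hn : (P.twistGlue Φ₀).n = P.n := rfl
  unfold thetaLocalAt
  by_cases h : HullDefinedAt P o j vQ
  · rw [if_pos h, if_pos (hd.mpr h), hh, hn]
  · rw [if_neg h, if_neg fun hc => h (hd.mp hc)]

/-- The finiteness clause of an arbitrary input is twist-invariant. [folklore] -/
theorem twistGlue_thetaFiniteAt_iff (hΦ₀ : Φ₀ ∈ Setting.indGroup S) (o : P.Ob P.sig.Clgp) :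
    ThetaFiniteAt (P.twistGlue Φ₀) o ↔ ThetaFiniteAt P o := by
  have hl : thetaLocalAt (P.twistGlue Φ₀) o = thetaLocalAt P o :=
    funext fun j => funext fun vQ => twistGlue_thetaLocalAt P Φ₀ hΦ₀ o j vQ
  unfold ThetaFiniteAt
  rw [hl]

/-- **The global hull volume of EVERY input is invariant under the Θ-side Kummer re-choice** (row C-1's
`twistGlue_negLogTheta`, input free); pure orbit algebra, no volume hypothesis. [folklore] -/
theorem twistGlue_negLogThetaAt (hΦ₀ : Φ₀ ∈ Setting.indGroup S) (o : P.Ob P.sig.Clgp) :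
    negLogThetaAt (P.twistGlue Φ₀) o = negLogThetaAt P o := by
  have hl : thetaLocalAt (P.twistGlue Φ₀) o = thetaLocalAt P o :=
    funext fun j => funext fun vQ => twistGlue_thetaLocalAt P Φ₀ hΦ₀ o j vQ
  have hf := twistGlue_thetaFiniteAt_iff P Φ₀ hΦ₀ o
  unfold negLogThetaAt
  by_cases h : ThetaFiniteAt P o
  · rw [if_pos h, if_pos (hf.mpr h), hl]
  · rw [if_neg h, if_neg fun hc => h (hf.mp hc)]

/-- The q-side volume of any input is untouched by the Θ-side twist (definitional). [folklore] -/
theorem twistGlue_negLogQAt (o' : P.ObΔ) :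
    negLogQAt (P.twistGlue Φ₀) o' = negLogQAt P o' := rfl

/-- The Step (xi-a) gluing transports to the twisted setting (object types and pilots untouched). [folklore] -/
def LinkGluing.twist (G : LinkGluing P) : LinkGluing (P.twistGlue Φ₀) :=
  ⟨G.linkMap, G.link_thetaPilot⟩

/-- The transported gluing has the same underlying map (definitional). [folklore] -/
theorem LinkGluing.twist_linkMap (G : LinkGluing P) (o : P.Ob P.sig.Clgp) :
    (G.twist P Φ₀).linkMap o = G.linkMap o := rfl

/-- **GapA IS INVARIANT UNDER THE Θ-SIDE KUMMER RE-CHOICE** (row C-8, Θ-half): the (Ind1)(Ind2)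
re-choice of p. 173 l. 49 – p. 174 l. 3 changes nothing. No volume hypothesis. [folklore] -/
theorem twistGlue_soundAtInput_iff (G : LinkGluing P) (hΦ₀ : Φ₀ ∈ Setting.indGroup S) :
    SoundAtInput (P.twistGlue Φ₀) (G.twist P Φ₀) ↔ SoundAtInput P G := by
  unfold SoundAtInput
  refine forall_congr' fun o => ?_
  rw [twistGlue_negLogThetaAt P Φ₀ hΦ₀ o, LinkGluing.twist_linkMap P Φ₀ G o,
    twistGlue_negLogQAt P Φ₀ (G.linkMap o)]

end ThetaTwist

/-! ## 3. The column: GapA is invariant under the étale-picture transport (row C-3 at every input) -/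

section Recolumn
variable (n' : ℤ) (Φ : S.L.PacketAut) (hD : S.D n' = (S.D P.n).map Φ)

/-- The transported Θ-glue at an arbitrary input is the `Φ`-translate (definitional). [folklore] -/
theorem recolumn_thetaRegionOfAt (m : ℤ) (o : P.Ob P.sig.Clgp) (j : T.Label) (vQ : T.VQ) :
    (P.recolumn n' Φ hD).thetaRegionOf m o j vQ = Φ j vQ '' P.thetaRegionOf m o j vQ := rfl

/-- Same possible images of every object (the transported glue IS the twisted glue). [folklore] -/
theorem recolumn_possibleImagesAt (hΦ : Φ ∈ Setting.indGroup S) (o : P.Ob P.sig.Clgp)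
    (j : T.Label) (vQ : T.VQ) :
    possibleImagesAt (P.recolumn n' Φ hD) o j vQ = possibleImagesAt P o j vQ := by
  have h : possibleImagesAt (P.recolumn n' Φ hD) o j vQ =
      possibleImagesAt (P.twistGlue Φ) o j vQ := rfl
  rw [h, twistGlue_possibleImagesAt P Φ hΦ o j vQ]

/-- The transported hull of an arbitrary input is the `Φ`-translate of the original hull. [folklore] -/
theorem recolumn_thetaHullAt (hΦ : Φ ∈ Setting.indGroup S) (o : P.Ob P.sig.Clgp)
    (j : T.Label) (vQ : T.VQ) :
    thetaHullAt (P.recolumn n' Φ hD) o j vQ = Φ j vQ '' thetaHullAt P o j vQ := by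
  unfold thetaHullAt
  rw [show (P.recolumn n' Φ hD).frame j vQ = (P.frame j vQ).pushforward (Φ j vQ).toEquiv from rfl,
    HullFrame.pushforward_hull]
  show Φ j vQ '' (P.frame j vQ).hull
      (⇑(Φ j vQ).symm '' ⋃₀ possibleImagesAt (P.recolumn n' Φ hD) o j vQ) = _
  rw [recolumn_possibleImagesAt P n' Φ hD hΦ o j vQ, symm_image_sUnion_possibleImagesAt P hΦ o]

/-- Hull-definedness of an arbitrary input transports. [folklore] -/
theorem recolumn_hullDefinedAt_iff (hΦ : Φ ∈ Setting.indGroup S) (o : P.Ob P.sig.Clgp)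
    (j : T.Label) (vQ : T.VQ) :
    HullDefinedAt (P.recolumn n' Φ hD) o j vQ ↔ HullDefinedAt P o j vQ := by
  unfold HullDefinedAt
  rw [recolumn_possibleImagesAt P n' Φ hD hΦ o j vQ]
  show (P.frame j vQ).IsBounded (⇑(Φ j vQ).symm '' ⋃₀ possibleImagesAt P o j vQ) ∧
      (P.frame j vQ).HasHull (⇑(Φ j vQ).symm '' ⋃₀ possibleImagesAt P o j vQ) ↔ _
  rw [symm_image_sUnion_possibleImagesAt P hΦ o]

/-- The local hull volume of any input is column-transport-invariant (definitional cancellation). [folklore] -/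
theorem recolumn_thetaLocalAt (hΦ : Φ ∈ Setting.indGroup S) (o : P.Ob P.sig.Clgp)
    (j : T.Label) (vQ : T.VQ) :
    thetaLocalAt (P.recolumn n' Φ hD) o j vQ = thetaLocalAt P o j vQ := by
  have hd := recolumn_hullDefinedAt_iff P n' Φ hD hΦ o j vQ
  unfold thetaLocalAt
  by_cases h : HullDefinedAt P o j vQ
  · rw [if_pos h, if_pos (hd.mpr h)]
    rw [recolumn_thetaHullAt P n' Φ hD hΦ o j vQ]
    refine congrArg (fun r : ℝ => (r : WithTop ℝ)) ?_
    rw [P.recolumn_n n' Φ hD, hD]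
    show (S.D P.n).logvol j vQ (⇑(Φ j vQ).symm '' (Φ j vQ '' thetaHullAt P o j vQ)) = _
    rw [Setting.image_symm_image]
  · rw [if_neg h, if_neg fun hc => h (hd.mp hc)]

/-- The finiteness clause of an arbitrary input transports. [folklore] -/
theorem recolumn_thetaFiniteAt_iff (hΦ : Φ ∈ Setting.indGroup S) (o : P.Ob P.sig.Clgp) :
    ThetaFiniteAt (P.recolumn n' Φ hD) o ↔ ThetaFiniteAt P o := by
  have hl : thetaLocalAt (P.recolumn n' Φ hD) o = thetaLocalAt P o :=
    funext fun j => funext fun vQ => recolumn_thetaLocalAt P n' Φ hD hΦ o j vQ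
  unfold ThetaFiniteAt
  rw [hl]

/-- **The global hull volume of EVERY input is column-independent** (row C-3, input free). [folklore] -/
theorem recolumn_negLogThetaAt (hΦ : Φ ∈ Setting.indGroup S) (o : P.Ob P.sig.Clgp) :
    negLogThetaAt (P.recolumn n' Φ hD) o = negLogThetaAt P o := by
  have hl : thetaLocalAt (P.recolumn n' Φ hD) o = thetaLocalAt P o :=
    funext fun j => funext fun vQ => recolumn_thetaLocalAt P n' Φ hD hΦ o j vQ
  have hf := recolumn_thetaFiniteAt_iff P n' Φ hD hΦ o
  unfold negLogThetaAt
  by_cases h : ThetaFiniteAt P o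
  · rw [if_pos h, if_pos (hf.mpr h), hl]
  · rw [if_neg h, if_neg fun hc => h (hf.mp hc)]

/-- The local q-side volume of any input transports definitionally (row C-3, input free). [folklore] -/
theorem recolumn_qLocalAt (o' : P.ObΔ) (j : T.Label) (vQ : T.VQ) :
    qLocalAt (P.recolumn n' Φ hD) o' j vQ = qLocalAt P o' j vQ := by
  unfold qLocalAt
  rw [P.recolumn_n n' Φ hD, hD]
  show (S.D P.n).logvol j vQ (⇑(Φ j vQ).symm '' (Φ j vQ '' P.qRegionOf o' j vQ)) = _
  rw [Setting.image_symm_image]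

/-- The global q-side volume of EVERY input is column-independent. [folklore] -/
theorem recolumn_negLogQAt (o' : P.ObΔ) :
    negLogQAt (P.recolumn n' Φ hD) o' = negLogQAt P o' := by
  unfold negLogQAt
  congr 1
  funext i
  exact finsum_congr fun vQ => recolumn_qLocalAt P n' Φ hD o' (Setting.labelSucc i) vQ

/-- The gluing transports to the recolumned setting (object types and pilots untouched). [folklore] -/
def LinkGluing.recolumn (G : LinkGluing P) : LinkGluing (P.recolumn n' Φ hD) :=
  ⟨G.linkMap, G.link_thetaPilot⟩

/-- The transported gluing has the same underlying map (definitional). [folklore] -/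
theorem LinkGluing.recolumn_linkMap (G : LinkGluing P) (o : P.Ob P.sig.Clgp) :
    (G.recolumn P n' Φ hD).linkMap o = G.linkMap o := rfl

/-- **GapA IS COLUMN-INDEPENDENT** (row C-8, column half): the étale symmetry moves the comparison, not
its content. [folklore] -/
theorem recolumn_soundAtInput_iff (G : LinkGluing P) (hΦ : Φ ∈ Setting.indGroup S) :
    SoundAtInput (P.recolumn n' Φ hD) (G.recolumn P n' Φ hD) ↔ SoundAtInput P G := by
  unfold SoundAtInput
  refine forall_congr' fun o => ?_
  rw [recolumn_negLogThetaAt P n' Φ hD hΦ o, LinkGluing.recolumn_linkMap P n' Φ hD G o,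
    recolumn_negLogQAt P n' Φ hD (G.linkMap o)]

end Recolumn

/-- **GapA transports to every column** under the typed Thm. 3.11 (i) étale-symmetry (a HYPOTHESIS):
which vertical line carries the gap statement is immaterial (row C-3's exists-form). [folklore] -/
theorem exists_recolumn_soundAtInput_of_multiradialCompat (G : LinkGluing P)
    (hMR : S.MultiradialCompat) (n' : ℤ) :
    ∃ (P' : Cor312.Setting S) (G' : LinkGluing P'), P'.n = n' ∧
      (SoundAtInput P' G' ↔ SoundAtInput P G) := by
  obtain ⟨Φ, hΦ, hD⟩ := (Situation.multiradialCompat_iff_indGroup S).mp hMR P.n n'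
  have hΦ' : Φ ∈ Setting.indGroup S := hΦ
  exact ⟨P.recolumn n' Φ hD, G.recolumn P n' Φ hD, rfl,
    recolumn_soundAtInput_iff P n' Φ hD G hΦ'⟩

/-! ## 4. The q-side re-choice: invariance modulo Step (x) volume invariance (row C-7 at every input) -/

section QTwist
variable (Φ₀ : S.L.PacketAut)
  (hmem : ∀ (j : T.Label) (vQ : T.VQ),
    Φ₀ j vQ '' P.qRegionOf (qPilotObject P.qData) j vQ ∈ (P.frame j vQ).Hul)
  (hfin : ∀ j : T.Label, (Function.support fun vQ =>
    (S.D P.n).logvol j vQ (Φ₀ j vQ '' P.qRegionOf (qPilotObject P.qData) j vQ)).Finite)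

/-- The Θ-side quantity of EVERY input never reads the q-glue (definitional; row C-7, input free). [folklore] -/
theorem qTwistGlue_negLogThetaAt (o : P.Ob P.sig.Clgp) :
    negLogThetaAt (P.qTwistGlue Φ₀ hmem hfin) o = negLogThetaAt P o := rfl

/-- The twisted q-side local volume of any input is the volume of the `Φ₀`-translate (definitional). [folklore] -/
theorem qTwistGlue_qLocalAt (o' : P.ObΔ) (j : T.Label) (vQ : T.VQ) :
    qLocalAt (P.qTwistGlue Φ₀ hmem hfin) o' j vQ =
      (S.D P.n).logvol j vQ (Φ₀ j vQ '' P.qRegionOf o' j vQ) := rfl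

/-- Pointwise volume equality of the twisted q-glue images gives `negLogQAt` invariance. [folklore] -/
theorem qTwistGlue_negLogQAt_of_logvol
    (hvol : ∀ (o' : P.ObΔ) (j : T.Label) (vQ : T.VQ),
      (S.D P.n).logvol j vQ (Φ₀ j vQ '' P.qRegionOf o' j vQ) =
        (S.D P.n).logvol j vQ (P.qRegionOf o' j vQ))
    (o' : P.ObΔ) :
    negLogQAt (P.qTwistGlue Φ₀ hmem hfin) o' = negLogQAt P o' := by
  unfold negLogQAt
  congr 1
  funext i
  refine finsum_congr fun vQ => ?_
  show (S.D P.n).logvol (Setting.labelSucc i) vQ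
      (Φ₀ (Setting.labelSucc i) vQ '' P.qRegionOf o' (Setting.labelSucc i) vQ) =
    (S.D P.n).logvol (Setting.labelSucc i) vQ (P.qRegionOf o' (Setting.labelSucc i) vQ)
  exact hvol o' (Setting.labelSucc i) vQ

/-- Generator admissibility transport + `MRData.LogvolInvariant` (Step (x), p. 181 l. 2–5) + per-object
q-glue admissibility (`hadm`, EXPLICIT — the frozen `Setting` constrains only the q-pilot's image) give
the pointwise volume equality at EVERY object (row C-7, input free). [folklore] -/
theorem logvol_image_qRegionOf_eq_of_invariance
    (hAdm : ∀ Φ ∈ S.L.Ind1Family ∪ S.L.Ind2Family, ∀ (j : T.Label) (vQ : T.VQ)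
      (A : Set (S.L.Packet j vQ)), (S.D P.n).Adm j vQ A ↔ (S.D P.n).Adm j vQ (Φ j vQ '' A))
    (hvol : (S.D P.n).LogvolInvariant) (hΦ₀ : Φ₀ ∈ Setting.indGroup S)
    (hadm : ∀ (o' : P.ObΔ) (j : T.Label) (vQ : T.VQ), (S.D P.n).Adm j vQ (P.qRegionOf o' j vQ))
    (o' : P.ObΔ) (j : T.Label) (vQ : T.VQ) :
    (S.D P.n).logvol j vQ (Φ₀ j vQ '' P.qRegionOf o' j vQ) =
      (S.D P.n).logvol j vQ (P.qRegionOf o' j vQ) :=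
  ((S.D P.n).adm_and_logvol_eq_of_mem_closure hAdm hvol hΦ₀ j vQ _ (hadm o' j vQ)).2

/-- The gluing transports to the q-twisted setting (object types and pilots untouched). [folklore] -/
def LinkGluing.qTwist (G : LinkGluing P) : LinkGluing (P.qTwistGlue Φ₀ hmem hfin) :=
  ⟨G.linkMap, G.link_thetaPilot⟩

/-- The transported gluing has the same underlying map (definitional). [folklore] -/
theorem LinkGluing.qTwist_linkMap (G : LinkGluing P) (o : P.Ob P.sig.Clgp) :
    (G.qTwist P Φ₀ hmem hfin).linkMap o = G.linkMap o := rfl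

/-- **GapA invariance granted the pointwise volume equality**. [folklore] -/
theorem qTwistGlue_soundAtInput_iff_of_logvol (G : LinkGluing P)
    (hvol : ∀ (o' : P.ObΔ) (j : T.Label) (vQ : T.VQ),
      (S.D P.n).logvol j vQ (Φ₀ j vQ '' P.qRegionOf o' j vQ) =
        (S.D P.n).logvol j vQ (P.qRegionOf o' j vQ)) :
    SoundAtInput (P.qTwistGlue Φ₀ hmem hfin) (G.qTwist P Φ₀ hmem hfin) ↔ SoundAtInput P G := by
  unfold SoundAtInput
  refine forall_congr' fun o => ?_
  rw [qTwistGlue_negLogThetaAt P Φ₀ hmem hfin o, LinkGluing.qTwist_linkMap P Φ₀ hmem hfin G o,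
    qTwistGlue_negLogQAt_of_logvol P Φ₀ hmem hfin hvol (G.linkMap o)]

/-- **GapA IS INVARIANT UNDER THE q-SIDE KUMMER RE-CHOICE** (row C-8, q-half): granting Step (x)'s
volume invariance (generator form, as Team B discharges it) and per-object q-glue admissibility —
completing row C-7: the q-pilot's (Ind1)(Ind2)-exemption does no work at the volume level. [folklore] -/
theorem qTwistGlue_soundAtInput_iff_of_invariance (G : LinkGluing P)
    (hAdm : ∀ Φ ∈ S.L.Ind1Family ∪ S.L.Ind2Family, ∀ (j : T.Label) (vQ : T.VQ)
      (A : Set (S.L.Packet j vQ)), (S.D P.n).Adm j vQ A ↔ (S.D P.n).Adm j vQ (Φ j vQ '' A))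
    (hvol : (S.D P.n).LogvolInvariant) (hΦ₀ : Φ₀ ∈ Setting.indGroup S)
    (hadm : ∀ (o' : P.ObΔ) (j : T.Label) (vQ : T.VQ), (S.D P.n).Adm j vQ (P.qRegionOf o' j vQ)) :
    SoundAtInput (P.qTwistGlue Φ₀ hmem hfin) (G.qTwist P Φ₀ hmem hfin) ↔ SoundAtInput P G :=
  qTwistGlue_soundAtInput_iff_of_logvol P Φ₀ hmem hfin G
    (logvol_image_qRegionOf_eq_of_invariance P Φ₀ hAdm hvol hΦ₀ hadm)

end QTwist

/-! ## 5. Composition: the two unforced re-choices compose -/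

/-- **GapA is canonical on the orbit of the frozen data** (C-1 ∘ C-3): the inference of GAP-LEDGER row
G-c312-9-1 depends on neither Kummer representative nor column. [folklore] -/
theorem twist_recolumn_soundAtInput_iff (G : LinkGluing P) (Φ₀ : S.L.PacketAut)
    (hΦ₀ : Φ₀ ∈ Setting.indGroup S) (n' : ℤ) (Φ : S.L.PacketAut)
    (hD : S.D n' = (S.D P.n).map Φ) (hΦ : Φ ∈ Setting.indGroup S) :
    SoundAtInput ((P.twistGlue Φ₀).recolumn n' Φ hD)
        ((G.twist P Φ₀).recolumn (P.twistGlue Φ₀) n' Φ hD) ↔ SoundAtInput P G :=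
  (recolumn_soundAtInput_iff (P.twistGlue Φ₀) n' Φ hD (G.twist P Φ₀) hΦ).trans
    (twistGlue_soundAtInput_iff P Φ₀ G hΦ₀)

end Cor312Vol

end IUTFork

end Summit.ABC

end
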